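import Literature.Geometry.Kaehler.ComplexTorusWeylOperatorHodgeTypes
import Literature.Geometry.Kaehler.ComplexTorusTranscendentalLatticeHodgeModule
import Literature.Algebra.Lie.LefschetzModuleWeylOperatorSelfAdjoint
import HarnessLib

/-!
# `L_η`, `Λ_η` and the Weyl operator `w` are SELF-ADJOINT for the cup-product pairing of a complex torus, for EVERY non-degenerate
# real `2`-form `η` and in every dimension; Parseval for `w`; `φ^*F` is self-adjoint
# (André 1996, §1.1: "`L`, `*_L`, `*_H` et `ᶜΛ` sont auto-adjoints relativement à l'accouplement de dualité de Poincaré")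

Layer `Literature/Geometry/Kaehler`, namespace `Literature.Geometry.Kaehler.ComplexTorus`; lane `lit-hodgefound` (Track 2 foundations
library), prover seat `lit-hodgefound-p09` (generation 52, row g52-#3). THEOREMS ONLY (no definition, no named fact, no instance, no
notation; D-0026 net debt `0`). It reads the ABSTRACT rows g30-#3 / g31-#4 (`Algebra/Lie/LefschetzModuleSelfAdjoint`,
`…WeylOperatorSelfAdjoint`: for a bilinear form `B` with `h` skew-adjoint and `e` self-adjoint, the `𝔰𝔩₂`-partner `f`, the Weyl operator
`w` and André's involutions are `B`-self-adjoint) on the torus-forms carrier, and thereby REMOVES the hypotheses of row g50-#6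
`ComplexTorusLefschetzDualPoincareSelfAdjoint` (`⟨Λ_η x, y⟩ = ⟨x, Λ_η y⟩` proved there by the Fourier transform for a POLARISATION `η` of a
torus of dimension `g ≥ 2`): here `η` is any non-degenerate real `2`-form and `g ≥ 1`.

SETTING. `X = E/Φ(ℤ^ι)` a complex torus, `g = dim_ℂ E`, `e : Fin N ≃ ι` a lattice frame (`N = 2g`), `⟨x, y⟩_e = poincarePairing Φ e h x y =
(x ∧ y)(λ_{e(1)}, …, λ_{e(N)})` the cup-product pairing of complementary degrees `k + l = N` (`ComplexTorusPoincareDuality`), `η` a real `2`-form,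
`L_η = lefschetzPow η 1` / `lefschetzG η`, `Λ_η = lefschetzDual η m` / `lefschetzDualG η`, `H = countingG E` (`k − g` on `Hᵏ`),
`w = (hasLefschetzProperty_lefschetzG hη).weylOperator isZGrading_countingG` the Weyl operator of the Lefschetz `𝔰𝔩₂` on `H•(X; ℂ) = GForm E ℂ`
(homogeneous of degree `2g − 2k` on `Hᵏ`: `w(of k x) = of m ((w (of k x)) m)`, `k + m = 2g`, row g51-#10 `weylOperator_of_eq_of`).

THE GRADED PAIRING. Inside the proofs (no definition is introduced) the degree-wise pairings are assembled into ONE bilinear form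
`B(w, w') = Σ_{k+l=N} ⟨w_k, w'_l⟩_e` on `GForm E ℂ` (`exists_gradedPairing₆₃`); `H` is `B`-skew-adjoint (`(k − g) = −(l − g)` for `k + l = 2g`)
and `L_η` is `B`-self-adjoint (`⟨η ∧ x, y⟩ = ⟨x, η ∧ y⟩`: associativity and graded commutativity of `∧`), which is all the abstract rows need.

## What is proved

* §1 `poincarePairing_lefschetzPow_one_comm` (**`⟨L_η x, y⟩ = ⟨x, L_η y⟩`**, any real `2`-form), `poincarePairing_countingG_skew`
  (`⟨(k−g) x, y⟩ = −⟨x, (l−g) y⟩`).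
* §2 **`poincarePairing_lefschetzDual_comm_of_nondegenerate`: `⟨Λ_η x, y⟩ = ⟨x, Λ_η y⟩`** for all `x ∈ H^{m+2}`, `y ∈ H^{m'+2}`, `m + m' + 2 = 2g`,
  EVERY non-degenerate `η`, every `g ≥ 1` (abstract `isSelfAdjoint_dual`: the `𝔰𝔩₂`-partner of a self-adjoint `e` for a skew `h` is self-adjoint —
  "`ᶜΛ` […] auto-adjoint"); this supersedes row g50-#6's `IsRiemannForm.poincarePairing_lefschetzDual_comm` (`η` a polarisation, `4 ≤ rk Λ`).
* §3 **`poincarePairing_weylOperator_comm`: `⟨w(x), y⟩ = ⟨x, w(y)⟩` for `x, y ∈ Hᵏ(X; ℂ)`** (`w(x) ∈ H^{2g−k}`; abstract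
  `isSelfAdjoint_weylOperator` — André's "`*_H` auto-adjoint", `w = ± *_H` on strings), and **PARSEVAL FOR `w`**:
  `poincarePairing_weylOperator_weylOperator`: `⟨w(x), w(y)⟩ = (−1)^{g+k} ⟨x, y⟩` for `x ∈ Hᵏ`, `y ∈ H^{2g−k}` (`w² = (−1)^{k−g}` on `Hᵏ`).
* §4 For a Riemann form of type `d` and any real-linear `φ` with `Im φ(u)(w) = η(u, w)` (e.g. `φ_H`): **`IsPolarizationType.poincarePairing_fourierForm_compContinuousLinearMap_comm`:
  `⟨φ^*F x, y⟩ = ⟨x, φ^*F y⟩` for `x, y ∈ Hᵏ`** (`φ^* ∘ F = (−1)^g χ(d) · w`, row g51-#4), the principal form with `φ_H`, and Parseval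
  `IsPolarizationType.poincarePairing_fourierForm_compContinuousLinearMap_self`: `⟨φ^*F x, φ^*F y⟩ = (−1)^{g+k} χ(d)² ⟨x, y⟩`.

## Sources, VERBATIM

* Y. André, *Pour une théorie inconditionnelle des motifs*, Publ. Math. IHÉS 83 (1996) [Andre1996Motifs], §1.1 (p. 11; held
  `paper:doi-10-1007-bf02698643` p0008 L12–L14): "Remarquons aussi que `L`, `*_L`, `*_H` et `ᶜΛ` sont auto-adjoints relativement à l'accouplement de
  dualité de Poincaré `(x, y) ↦ ∫ x ∪ y`."; §1.2 (p. 11): the element `(0 1 ; −1 0)` of `SL₂` "s'envoie sur `± *_H`" on each string.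
* D. Huybrechts, *Complex Geometry* (2005) [Huybrechts2005], §1.2 Def. 1.2.21, Lemma 1.2.23 (`Λ` as the adjoint of `L`).
* H. Lange, *Abelian Varieties over the Complex Numbers* (2023) [Lange2023AbelianVarietiesComplex], §6.2.4 Prop. 6.2.20 (pp. 310–311: Parseval for
  the cohomological Fourier transform, `⟨F a, F b⟩ = ± ⟨a, b⟩`), §1.4.1 (p. 37: the cup-product pairing on `Alt•(Λ, ℤ)`).
* A. Polishchuk, *Fourier-stable subrings in the Chow rings of abelian varieties* (2007) [Polishchuk2007FourierStable], §1 Lemma 1.4 (p. 3)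
  ("`(−1)^g F_d = exp(e)exp(−f)exp(e)`", `F_d = χ(d)⁻¹ φ^* ∘ F`).
-/

noncomputable section

-- `Module ℂ` / `SMulZeroClass ℂ` synthesis on `E [⋀^Fin k]→L[ℝ] ℂ` (as in `ComplexTorusLefschetzDecomposition`)
set_option maxSynthPendingDepth 3

namespace Literature.Geometry.Kaehler

namespace ComplexTorus

open Module Function Finset
open Literature.LinearAlgebra.Alternating Literature.Algebra.Lie

universe uE

variable {ι : Type*} [Fintype ι] [DecidableEq ι] {E : Type uE} [NormedAddCommGroup E] [NormedSpace ℂ E] [FiniteDimensional ℂ E]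
  [Nontrivial E] (Φ : (ι → ℝ) ≃L[ℝ] E) {η : E [⋀^Fin 2]→L[ℝ] ℝ} {N : ℕ}

/-! ## §0 Degree casts and the graded pairing `B = Σ_{k+l=N} ⟨·_k, ·_l⟩` (private) -/

section Graded

omit [Fintype ι] [FiniteDimensional ℂ E] [Nontrivial E] in
/-- Reindexing the left argument along an equation of degrees. [folklore] -/
private theorem poincarePairing_domDomCongr_left₆₃ (e : Fin N ≃ ι) {k k' l : ℕ} (hk : k = k') (h : k + l = N) (h' : k' + l = N)
    (γ : E [⋀^Fin k]→L[ℝ] ℂ) (δ : E [⋀^Fin l]→L[ℝ] ℂ) :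
    poincarePairing Φ e h' (γ.domDomCongr (finCongr hk)) δ = poincarePairing Φ e h γ δ := by
  subst hk; rfl

omit [Fintype ι] [FiniteDimensional ℂ E] [Nontrivial E] in
/-- Reindexing the right argument along an equation of degrees. [folklore] -/
private theorem poincarePairing_domDomCongr_right₆₃ (e : Fin N ≃ ι) {k l l' : ℕ} (hl : l = l') (h : k + l = N) (h' : k + l' = N)
    (γ : E [⋀^Fin k]→L[ℝ] ℂ) (δ : E [⋀^Fin l]→L[ℝ] ℂ) :
    poincarePairing Φ e h' γ (δ.domDomCongr (finCongr hl)) = poincarePairing Φ e h γ δ := by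
  subst hl; rfl

omit [Fintype ι] [FiniteDimensional ℂ E] [Nontrivial E] in
/-- **The graded cup-product pairing `B(w, w') = Σ_{k+l=N} ⟨w_k, w'_l⟩_e` on `H•(X; ℂ)`** exists as a bilinear form restricting to `⟨ , ⟩_e` on
complementary homogeneous components and to `0` on the others (assembled from Mathlib's `LinearMap.proj` / `compl₁₂`; used only inside
this file's proofs). [cite: Andre1996Motifs, §1.1 (p. 11, "(x, y) ↦ ∫ x ∪ y")] [cite: Lange2023AbelianVarietiesComplex, §1.4.1 (p. 37)] -/
private theorem exists_gradedPairing₆₃ (e : Fin N ≃ ι) :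
    ∃ B : LinearMap.BilinForm ℂ (GForm E ℂ),
      (∀ (k l : ℕ) (h : k + l = N) (x : E [⋀^Fin k]→L[ℝ] ℂ) (y : E [⋀^Fin l]→L[ℝ] ℂ),
          B (GForm.of k x) (GForm.of l y) = poincarePairing Φ e h x y) ∧
      (∀ (k l : ℕ), k + l ≠ N → ∀ (x : E [⋀^Fin k]→L[ℝ] ℂ) (y : E [⋀^Fin l]→L[ℝ] ℂ), B (GForm.of k x) (GForm.of l y) = 0) := by
  classical
  refine ⟨∑ k ∈ Finset.range (N + 1), ∑ l ∈ Finset.range (N + 1),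
    if h : k + l = N then (poincarePairing Φ e h).compl₁₂ (LinearMap.proj (R := ℂ) (φ := fun m ↦ E [⋀^Fin m]→L[ℝ] ℂ) k)
      (LinearMap.proj (R := ℂ) (φ := fun m ↦ E [⋀^Fin m]→L[ℝ] ℂ) l) else 0, fun k l h x y ↦ ?_, fun k l hkl x y ↦ ?_⟩
  · simp only [LinearMap.sum_apply]
    rw [Finset.sum_eq_single_of_mem k (Finset.mem_range.2 (by omega)) fun k' _ hk' ↦ ?_]
    · rw [Finset.sum_eq_single_of_mem l (Finset.mem_range.2 (by omega)) fun l' _ hl' ↦ ?_]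
      · rw [dif_pos h, LinearMap.compl₁₂_apply, LinearMap.proj_apply, LinearMap.proj_apply, GForm.of_apply_self, GForm.of_apply_self]
      · split_ifs with h'
        · rw [LinearMap.compl₁₂_apply, LinearMap.proj_apply, LinearMap.proj_apply, GForm.of_apply_of_ne hl', map_zero]
        · rw [LinearMap.zero_apply, LinearMap.zero_apply]
    · refine Finset.sum_eq_zero fun l' _ ↦ ?_
      split_ifs with h'
      · rw [LinearMap.compl₁₂_apply, LinearMap.proj_apply, LinearMap.proj_apply, GForm.of_apply_of_ne hk', map_zero, LinearMap.zero_apply]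
      · rw [LinearMap.zero_apply, LinearMap.zero_apply]
  · simp only [LinearMap.sum_apply]
    refine Finset.sum_eq_zero fun k' _ ↦ Finset.sum_eq_zero fun l' _ ↦ ?_
    split_ifs with h'
    · rw [LinearMap.compl₁₂_apply, LinearMap.proj_apply, LinearMap.proj_apply]
      by_cases hk' : k' = k
      · subst hk'
        have hl' : l' ≠ l := fun hll ↦ hkl (hll ▸ h')
        rw [GForm.of_apply_of_ne hl', map_zero]
      · rw [GForm.of_apply_of_ne hk', map_zero, LinearMap.zero_apply]
    · rw [LinearMap.zero_apply, LinearMap.zero_apply]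

omit [Fintype ι] [DecidableEq ι] [Nontrivial E] in
/-- An adjoint pair is detected on homogeneous elements (every graded form is the finite sum of its components). [folklore] -/
private theorem isAdjointPair_of_forall_of₆₃ {B : LinearMap.BilinForm ℂ (GForm E ℂ)} {S T : Module.End ℂ (GForm E ℂ)}
    (hST : ∀ (a b : ℕ) (x : E [⋀^Fin a]→L[ℝ] ℂ) (y : E [⋀^Fin b]→L[ℝ] ℂ),
      B (S (GForm.of a x)) (GForm.of b y) = B (GForm.of a x) (T (GForm.of b y))) :
    LinearMap.IsAdjointPair B B S T := by
  intro w w'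
  conv_lhs => rw [← sum_range_of_eq w, ← sum_range_of_eq w']
  conv_rhs => rw [← sum_range_of_eq w, ← sum_range_of_eq w']
  simp only [map_sum, LinearMap.sum_apply, hST]

end Graded

/-! ## §1 `L_η` is self-adjoint and `H` is skew-adjoint for the cup-product pairing -/

section LefschetzOperator

omit [Fintype ι] [FiniteDimensional ℂ E] [Nontrivial E] in
/-- **"`L` […] auto-adjoint": `⟨L_η x, y⟩ = ⟨x, L_η y⟩`** for every real `2`-form `η`, `x ∈ Hᵃ`, `y ∈ Hᵇ`, `a + b + 2 = N` — associativity
`(η ∧ x) ∧ y = η ∧ (x ∧ y)` and graded commutativity `x ∧ η = η ∧ x` (`η` of even degree). [cite: Andre1996Motifs, §1.1 (p. 11)]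
[cite: Huybrechts2005, §1.2 Lemma 1.2.23] -/
theorem poincarePairing_lefschetzPow_one_comm (η : E [⋀^Fin 2]→L[ℝ] ℝ) (e : Fin N ≃ ι) {a b : ℕ} (h₁ : (a + 2) + b = N)
    (h₂ : a + (b + 2) = N) (ha : 2 * 1 + a = a + 2) (hb : 2 * 1 + b = b + 2) (x : E [⋀^Fin a]→L[ℝ] ℂ) (y : E [⋀^Fin b]→L[ℝ] ℂ) :
    poincarePairing Φ e h₁ (lefschetzPow η 1 ha x) y = poincarePairing Φ e h₂ x (lefschetzPow η 1 hb y) := by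
  rw [lefschetzPow_apply, lefschetzPow_apply,
    poincarePairing_domDomCongr_left₆₃ Φ e ha (show 2 * 1 + a + b = N by omega) h₁,
    poincarePairing_domDomCongr_right₆₃ Φ e hb (show a + (2 * 1 + b) = N by omega) h₂,
    poincarePairing_wedge_left Φ e (show 2 * 1 + a + b = N by omega) (show 2 * 1 + (a + b) = N by omega),
    poincarePairing_wedge_right_comm Φ e (show a + (2 * 1 + b) = N by omega) (show a + b + 2 * 1 = N by omega),
    poincarePairing_comm Φ e (show 2 * 1 + (a + b) = N by omega) (show a + b + 2 * 1 = N by omega),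
    ← mul_assoc, ← pow_add, show b * (2 * 1) + 2 * 1 * (a + b) = 2 * (b + (a + b)) by ring, pow_mul, neg_one_sq, one_pow, one_mul]

omit [FiniteDimensional ℂ E] [Nontrivial E] in
/-- **`H = deg − g` is skew-adjoint: `⟨H x, y⟩ = −⟨x, H y⟩`** on complementary degrees (`(a − g) + (b − g) = 0` for `a + b = 2g`).
[cite: Andre1996Motifs, §1.1 (p. 11)] -/
theorem poincarePairing_countingG_skew (e : Fin N ≃ ι) {a b : ℕ} (h : a + b = N) (x : E [⋀^Fin a]→L[ℝ] ℂ) (y : E [⋀^Fin b]→L[ℝ] ℂ) :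
    poincarePairing Φ e h (((a : ℂ) - (finrank ℂ E : ℂ)) • x) y = -poincarePairing Φ e h x (((b : ℂ) - (finrank ℂ E : ℂ)) • y) := by
  have hN := finrank_complex_mul_two Φ e
  have hab : (a : ℂ) + (b : ℂ) = 2 * (finrank ℂ E : ℂ) := by exact_mod_cast (show a + b = 2 * finrank ℂ E by omega)
  rw [map_smul, LinearMap.smul_apply, map_smul, smul_eq_mul, smul_eq_mul, ← neg_mul,
    show -((b : ℂ) - (finrank ℂ E : ℂ)) = (a : ℂ) - (finrank ℂ E : ℂ) by linear_combination -hab]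

omit [Nontrivial E] in
/-- The graded pairing with its two adjointness properties (private packaging for §2–§4). [cite: Andre1996Motifs, §1.1 (p. 11)] -/
private theorem exists_gradedPairing_skew_self₆₃ (η : E [⋀^Fin 2]→L[ℝ] ℝ) (e : Fin N ≃ ι) :
    ∃ B : LinearMap.BilinForm ℂ (GForm E ℂ),
      (∀ (k l : ℕ) (h : k + l = N) (x : E [⋀^Fin k]→L[ℝ] ℂ) (y : E [⋀^Fin l]→L[ℝ] ℂ),
          B (GForm.of k x) (GForm.of l y) = poincarePairing Φ e h x y) ∧
      (∀ (k l : ℕ), k + l ≠ N → ∀ (x : E [⋀^Fin k]→L[ℝ] ℂ) (y : E [⋀^Fin l]→L[ℝ] ℂ), B (GForm.of k x) (GForm.of l y) = 0) ∧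
      B.IsSkewAdjoint (countingG E) ∧ B.IsSelfAdjoint (lefschetzG η) := by
  obtain ⟨B, hB, hB0⟩ := exists_gradedPairing₆₃ Φ e
  refine ⟨B, hB, hB0, ?_, ?_⟩
  · change LinearMap.IsAdjointPair B B ⇑(countingG E) ⇑(-countingG E)
    refine isAdjointPair_of_forall_of₆₃ fun a b x y ↦ ?_
    rw [countingG_of, LinearMap.neg_apply, countingG_of, map_neg, ← GForm.of_smul, ← GForm.of_smul]
    by_cases h : a + b = N
    · rw [hB a b h, hB a b h, poincarePairing_countingG_skew Φ e h]
    · rw [hB0 a b h, hB0 a b h, neg_zero]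
  · refine isAdjointPair_of_forall_of₆₃ fun a b x y ↦ ?_
    rw [lefschetzG_of, lefschetzG_of]
    by_cases h : (a + 2) + b = N
    · rw [hB _ _ h, hB _ _ (show a + (b + 2) = N by omega), poincarePairing_lefschetzPow_one_comm Φ η e h (by omega)]
    · rw [hB0 _ _ h, hB0 _ _ (show a + (b + 2) ≠ N by omega)]

end LefschetzOperator

/-! ## §2 `Λ_η` is self-adjoint for every non-degenerate `η`, in every dimension -/

section Dual

/-- **"`ᶜΛ` […] auto-adjoint": `⟨Λ_η x, y⟩ = ⟨x, Λ_η y⟩` for EVERY non-degenerate real `2`-form `η` on a complex torus of any dimension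
`g ≥ 1`** (`x ∈ H^{m+2}`, `y ∈ H^{m'+2}`, `m + m' + 2 = 2g`): the `𝔰𝔩₂`-partner `Λ_η` of the self-adjoint `L_η` for the skew-adjoint `H` is
self-adjoint (abstract row g30-#3 `isSelfAdjoint_dual`, which computes both sides on pairs of `𝔰𝔩₂`-strings). Row g50-#6 proved this for a
polarisation on a torus of dimension `≥ 2` through the Fourier transform; no polarisation and no dimension bound is needed.
[cite: Andre1996Motifs, §1.1 (p. 11)] [cite: Huybrechts2005, §1.2 Def. 1.2.21, Lemma 1.2.23] -/
theorem poincarePairing_lefschetzDual_comm_of_nondegenerate (hη : ∀ v : E, v ≠ 0 → ∃ w : E, η ![v, w] ≠ 0) (e : Fin N ≃ ι) {m m' : ℕ}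
    (h₁ : m + (m' + 2) = N) (h₂ : (m + 2) + m' = N) (x : E [⋀^Fin (m + 2)]→L[ℝ] ℂ) (y : E [⋀^Fin (m' + 2)]→L[ℝ] ℂ) :
    poincarePairing Φ e h₁ (lefschetzDual η m x) y = poincarePairing Φ e h₂ x (lefschetzDual η m' y) := by
  obtain ⟨B, hB, -, hh, he⟩ := exists_gradedPairing_skew_self₆₃ Φ η e
  have key := (hasLefschetzProperty_lefschetzG hη).isSelfAdjoint_dual isZGrading_countingG hh he (GForm.of (m + 2) x) (GForm.of (m' + 2) y)
  rwa [dual_lefschetzG_eq_lefschetzDualG hη, lefschetzDualG_of_add_two, lefschetzDualG_of_add_two, hB _ _ h₁, hB _ _ h₂] at key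

end Dual

/-! ## §3 The Weyl operator is self-adjoint; Parseval for `w` -/

section Weyl

/-- **"`*_H` […] auto-adjoint" for the Weyl operator: `⟨w(x), y⟩ = ⟨x, w(y)⟩` for all `x, y ∈ Hᵏ(X; ℂ)`** and every non-degenerate `η`
(`w(x) = (w (of k x))_m ∈ Hᵐ`, `k + m = 2g`): abstract row g31-#4 `isSelfAdjoint_weylOperator` (on matched strings both sides carry the
coefficient `(−1)^{n+j} j!/(n−j)!`), read through the graded cup-product pairing. André: the element `(0 1 ; −1 0)` acts by `± *_H` on each
string and `*_H` is self-adjoint. [cite: Andre1996Motifs, §1.1 (p. 11) and §1.2 (p. 11)] -/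
theorem poincarePairing_weylOperator_comm (hη : ∀ v : E, v ≠ 0 → ∃ w : E, η ![v, w] ≠ 0) (e : Fin N ≃ ι) {k m : ℕ} (h₁ : m + k = N)
    (h₂ : k + m = N) (x y : E [⋀^Fin k]→L[ℝ] ℂ) :
    poincarePairing Φ e h₁ ((hasLefschetzProperty_lefschetzG hη).weylOperator isZGrading_countingG (GForm.of k x) m) y =
      poincarePairing Φ e h₂ x ((hasLefschetzProperty_lefschetzG hη).weylOperator isZGrading_countingG (GForm.of k y) m) := by
  obtain ⟨B, hB, -, hh, he⟩ := exists_gradedPairing_skew_self₆₃ Φ η e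
  have hN := finrank_complex_mul_two Φ e
  have key := (hasLefschetzProperty_lefschetzG hη).isSelfAdjoint_weylOperator isZGrading_countingG hh he (GForm.of k x) (GForm.of k y)
  rwa [weylOperator_of_eq_of hη (show k + m = 2 * finrank ℂ E by omega) x, weylOperator_of_eq_of hη (show k + m = 2 * finrank ℂ E by omega) y,
    hB _ _ h₁, hB _ _ h₂] at key

omit [Fintype ι] [DecidableEq ι] [FiniteDimensional ℂ E] [Nontrivial E] in
/-- `(−1)^{|m − g|} = (−1)^{g + m}`. [folklore] -/
private theorem neg_one_pow_natAbs_sub₆₃ (m g : ℕ) : (-1 : ℂ) ^ ((m : ℤ) - (g : ℤ)).natAbs = (-1) ^ (g + m) := by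
  obtain h | h := le_total g m
  · rw [show ((m : ℤ) - g).natAbs = m - g by omega, show g + m = (m - g) + 2 * g by omega, pow_add, pow_mul, neg_one_sq, one_pow, mul_one]
  · rw [show ((m : ℤ) - g).natAbs = g - m by omega, show g + m = (g - m) + 2 * m by omega, pow_add, pow_mul, neg_one_sq, one_pow, mul_one]

/-- **PARSEVAL FOR THE WEYL OPERATOR: `⟨w(x), w(y)⟩ = (−1)^{g+k} ⟨x, y⟩`** for `x ∈ Hᵏ`, `y ∈ Hᵐ`, `k + m = 2g` (`w(x) ∈ Hᵐ`, `w(y) ∈ Hᵏ`):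
self-adjointness and `w² = (−1)^{m−g}` on `Hᵐ` (the centre of `SL₂`). Compare Lange's Parseval `⟨F a, F b⟩_X̂ = ± ⟨a, b⟩_X` for the
cohomological Fourier transform (Prop. 6.2.20), of which this is the intrinsic form on `X` (`φ^* ∘ F = ± χ · w`).
[cite: Andre1996Motifs, §1.1–§1.2 (p. 11)] [cite: Lange2023AbelianVarietiesComplex, §6.2.4 Prop. 6.2.20 (pp. 310–311)] -/
theorem poincarePairing_weylOperator_weylOperator (hη : ∀ v : E, v ≠ 0 → ∃ w : E, η ![v, w] ≠ 0) (e : Fin N ≃ ι) {k m : ℕ}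
    (h₁ : m + k = N) (h₂ : k + m = N) (x : E [⋀^Fin k]→L[ℝ] ℂ) (y : E [⋀^Fin m]→L[ℝ] ℂ) :
    poincarePairing Φ e h₁ ((hasLefschetzProperty_lefschetzG hη).weylOperator isZGrading_countingG (GForm.of k x) m)
        ((hasLefschetzProperty_lefschetzG hη).weylOperator isZGrading_countingG (GForm.of m y) k) =
      (-1 : ℂ) ^ (finrank ℂ E + m) * poincarePairing Φ e h₂ x y := by
  obtain ⟨B, hB, -, hh, he⟩ := exists_gradedPairing_skew_self₆₃ Φ η e
  have hN := finrank_complex_mul_two Φ e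
  have key := (hasLefschetzProperty_lefschetzG hη).isSelfAdjoint_weylOperator isZGrading_countingG hh he (GForm.of k x)
    ((hasLefschetzProperty_lefschetzG hη).weylOperator isZGrading_countingG (GForm.of m y))
  rw [(hasLefschetzProperty_lefschetzG hη).weylOperator_weylOperator_apply_of_mem isZGrading_countingG
      (of_mem_degreeSpace_countingG (E := E) m y), map_smul, neg_one_pow_natAbs_sub₆₃,
    weylOperator_of_eq_of hη (show k + m = 2 * finrank ℂ E by omega) x, weylOperator_of_eq_of hη (show m + k = 2 * finrank ℂ E by omega) y,
    hB _ _ h₁, hB _ _ h₂, smul_eq_mul] at key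
  exact key

end Weyl

/-! ## §4 `φ^* ∘ F` is self-adjoint; Parseval on `X` -/

section Fourier

/-- **`⟨φ^*F(x), y⟩ = ⟨x, φ^*F(y)⟩` for `x, y ∈ Hᵏ(X; ℂ)`**, `η` a Riemann form of type `d`, `φ` any real-linear map with `Im φ(u)(w) = η(u, w)`
(`φ^* ∘ F = (−1)^g χ(d) · w`, row g51-#4, and §3). [cite: Andre1996Motifs, §1.1 (p. 11)] [cite: Polishchuk2007FourierStable, §1 Lemma 1.4 (p. 3)]
[cite: Lange2023AbelianVarietiesComplex, §6.2.4 Prop. 6.2.20 (pp. 310–311)] -/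
theorem IsPolarizationType.poincarePairing_fourierForm_compContinuousLinearMap_comm (hR : IsRiemannForm Φ η) {g : ℕ} {d : Fin g → ℕ}
    (hd : IsPolarizationType Φ η d) (hη : ∀ v : E, v ≠ 0 → ∃ w : E, η ![v, w] ≠ 0) (φ : E →L[ℝ] (E →L⋆[ℂ] ℂ))
    (hφ : ∀ u w, (φ u w).im = η ![u, w]) (e : Fin N ≃ ι) {k m : ℕ} (h₁ : m + k = N) (h₂ : k + m = N) (x y : E [⋀^Fin k]→L[ℝ] ℂ) :
    poincarePairing Φ e h₁ ((fourierForm Φ e h₂ x).compContinuousLinearMap φ) y =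
      poincarePairing Φ e h₂ x ((fourierForm Φ e h₂ y).compContinuousLinearMap φ) := by
  have hx := congr_fun (hd.of_fourierForm_compContinuousLinearMap Φ hR hη φ hφ e h₂ x) m
  have hy := congr_fun (hd.of_fourierForm_compContinuousLinearMap Φ hR hη φ hφ e h₂ y) m
  rw [GForm.of_apply_self, Pi.smul_apply] at hx hy
  rw [hx, hy, map_smul, LinearMap.smul_apply, map_smul, poincarePairing_weylOperator_comm Φ hη e h₁ h₂ x y]

/-- **Principal polarisation, `φ = φ_H`: `⟨φ_H^*F(x), y⟩ = ⟨x, φ_H^*F(y)⟩`** for `x, y ∈ Hᵏ(X; ℂ)`. [cite: Andre1996Motifs, §1.1 (p. 11)]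
[cite: Lange2023AbelianVarietiesComplex, §6.2.4 Prop. 6.2.20 (pp. 310–311)] -/
theorem IsPrincipalPolarization.poincarePairing_fourierForm_comp_phiHRep_comm (hp : IsPrincipalPolarization Φ η)
    (hη : ∀ v : E, v ≠ 0 → ∃ w : E, η ![v, w] ≠ 0) (e : Fin N ≃ ι) {k m : ℕ} (h₁ : m + k = N) (h₂ : k + m = N)
    (x y : E [⋀^Fin k]→L[ℝ] ℂ) :
    poincarePairing Φ e h₁ ((fourierForm Φ e h₂ x).compContinuousLinearMap ((phiHRep Φ hp.isRiemannForm.1).restrictScalars ℝ)) y =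
      poincarePairing Φ e h₂ x ((fourierForm Φ e h₂ y).compContinuousLinearMap ((phiHRep Φ hp.isRiemannForm.1).restrictScalars ℝ)) := by
  obtain ⟨g, d, hd, -⟩ := hp.exists_type_eq_one
  exact hd.poincarePairing_fourierForm_compContinuousLinearMap_comm Φ hp.isRiemannForm hη _ (fun u w ↦ im_phiHFun η u w) e h₁ h₂ x y

/-- **PARSEVAL ON `X`: `⟨φ^*F(x), φ^*F(y)⟩ = (−1)^{g+m} χ(d)² ⟨x, y⟩`** for `x ∈ Hᵏ`, `y ∈ Hᵐ`, `k + m = 2g` (`φ^* ∘ F = (−1)^g χ(d) · w` and §3;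
`χ(d)² = deg φ_L`). Lange's Prop. 6.2.20 is the Parseval identity between `X` and `X̂`; this is its pull-back to `X` along `φ`.
[cite: Lange2023AbelianVarietiesComplex, §6.2.4 Prop. 6.2.20 (pp. 310–311)] [cite: Polishchuk2007FourierStable, §1 Lemma 1.4 (p. 3)] -/
theorem IsPolarizationType.poincarePairing_fourierForm_compContinuousLinearMap_self (hR : IsRiemannForm Φ η) {g : ℕ} {d : Fin g → ℕ}
    (hd : IsPolarizationType Φ η d) (hη : ∀ v : E, v ≠ 0 → ∃ w : E, η ![v, w] ≠ 0) (φ : E →L[ℝ] (E →L⋆[ℂ] ℂ))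
    (hφ : ∀ u w, (φ u w).im = η ![u, w]) (e : Fin N ≃ ι) {k m : ℕ} (h₁ : m + k = N) (h₂ : k + m = N) (x : E [⋀^Fin k]→L[ℝ] ℂ)
    (y : E [⋀^Fin m]→L[ℝ] ℂ) :
    poincarePairing Φ e h₁ ((fourierForm Φ e h₂ x).compContinuousLinearMap φ) ((fourierForm Φ e h₁ y).compContinuousLinearMap φ) =
      (-1 : ℂ) ^ (g + m) * (∏ i, (d i : ℂ)) ^ 2 * poincarePairing Φ e h₂ x y := by
  have hcard : Fintype.card ι = N := by simpa using (Fintype.card_congr e).symm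
  have hg : g = finrank ℂ E := by have := hd.card_eq; have := finrank_complex_mul_two Φ e; omega
  have hx := congr_fun (hd.of_fourierForm_compContinuousLinearMap Φ hR hη φ hφ e h₂ x) m
  have hy := congr_fun (hd.of_fourierForm_compContinuousLinearMap Φ hR hη φ hφ e h₁ y) k
  rw [GForm.of_apply_self, Pi.smul_apply] at hx hy
  rw [hx, hy]
  simp only [map_smul, LinearMap.smul_apply, smul_eq_mul]
  rw [poincarePairing_weylOperator_weylOperator Φ hη e h₁ h₂ x y, ← hg]
  have h1 : (-1 : ℂ) ^ g * (-1) ^ g = 1 := by rw [← pow_add, ← two_mul, pow_mul, neg_one_sq, one_pow]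
  linear_combination (∏ i, (d i : ℂ)) ^ 2 * (-1 : ℂ) ^ (g + m) * poincarePairing Φ e h₂ x y * h1

end Fourier

end ComplexTorus

end Literature.Geometry.Kaehler

end
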